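import Summits.QuantumFields.YangMills.Theses.SlackWindow
import Summits.QuantumFields.YangMills.Theorems.SquareRootCeilingsMirrorDomination
import Summits.QuantumFields.YangMills.Theorems.SquareRootCeilingsDominationTransfer

/-!
# Route `SlackWindow` — the support `SlackLargeTransfer` (rev 2, ym-idea-11 g10 LINE 2), PROVED

`SlackLargeTransfer : SqrtDominationC → SlackLargeMirrorCeiling → (large-volume slack ceilings)`: the MEET CURRENCY
transfer (slack × RP-mirror × large volume; item stmt-QuantumFields-23560).  Fix the floor datum and a live level;
`SlackLargeMirrorCeiling` (stmt-QuantumFields-23559) gives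
`σ, C₁, ℓ₄, β₄` and, for each `β ≥ β₄`, a volume threshold `L₀(β)` and the slack ceiling
`b := (C₁/R⁴·((R s)⁻¹)^σ)²` on every same-orientation time-axis mirror covariance on odd tori `L ≥ max(4R+8, L₀)`;
reflection positivity (the landed bound-agnostic `MirrorDomination.abs_cov_le_of_axisMirror`, `β ≥ 0`) makes `b` a
bound on every `(2R+4)`-separated single-plane pair; the uniform-envelope `SqrtDomination` (stmt-QuantumFields-26902)
cashes it as `(C₂ n^θ √b)ⁿ`; `n = 0, 1` are trivial.  The threshold `L₀(β)` is simply threaded (it is the mirror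
ceiling's).  Also the edge `slackLargeMirrorCeiling_of_slackMirrorCeiling`: the all-tori crux `SlackMirrorCeiling`
(stmt-QuantumFields-23500) ⇒ `SlackLargeMirrorCeiling` (`L₀ := 0`).

HONEST LABEL: glue only.  `SlackLargeMirrorCeiling`, `SqrtDomination` and the calibration twin `SlackLargeCalibration`
stay OPEN; no summit, leaf (R2a-IV) or NT statement is proved; the YM mass gap is NOT proved.  Planner ym-idea-11 g10.

References: K. Osterwalder, E. Seiler, Ann. Phys. 110 (1978) 440, §2; J. Fröhlich, R. Israel, E. Lieb, B. Simon,
CMP 62 (1978) 1, Thm. 2.1.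
-/

set_option autoImplicit false

noncomputable section

namespace Summit.QuantumFields.YangMills.Theorems.SlackWindow

open MeasureTheory
open Literature.MathematicalPhysics.QuantumFieldTheory Literature.MathematicalPhysics.QuantumLattice
open Summit.QuantumFields.YangMills.Cruxes.OSLegsFromFemtoAndGap.DlrCollarTransfer
open Summit.QuantumFields.YangMills.Theses.SlackWindow
  (SqrtDominationC SlackMirrorCeiling SlackLargeMirrorCeiling SlackLargeTransfer)

/-- **Support `SlackLargeTransfer` of route `SlackWindow`** (rev 2): √-domination × RP-mirror transfer with the UV slack
`σ` and the volume threshold `L₀(β)` threaded. -/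
theorem slackLargeTransfer_proof : Summit.QuantumFields.YangMills.Theses.SlackWindow.SlackLargeTransfer := by
  intro hK2 hM G _ _ _ _ hG hSU
  letI : MeasurableSpace G := borel G
  haveI : BorelSpace G := ⟨rfl⟩
  intro r v f g h Λ₅
  obtain ⟨ε₀, hε₀, H1⟩ := hM G hG hSU r v f g h Λ₅
  refine ⟨ε₀, hε₀, fun ε hε hεle hfl => ?_⟩
  obtain ⟨σ, C₁, ℓ₄, β₄, hℓ₄, hC₁, H1'⟩ := H1 ε hε hεle hfl
  obtain ⟨C₂, θ, β₄', hC₂, hθ, H2⟩ := hK2 G hG hSU r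
  refine ⟨σ, C₂ * C₁, θ, ℓ₄, max (max β₄ β₄') 0, hℓ₄, mul_nonneg hC₂ hC₁, hθ, ?_⟩
  intro β hβ
  have hβ₁ : β₄ ≤ β := le_trans (le_trans (le_max_left _ _) (le_max_left _ _)) hβ
  have hβ₂ : β₄' ≤ β := le_trans (le_trans (le_max_right _ _) (le_max_left _ _)) hβ
  have hβ0 : (0 : ℝ) ≤ β := le_trans (le_max_right _ _) hβ
  obtain ⟨L₀, H1''⟩ := H1' β hβ₁
  refine ⟨L₀, ?_⟩
  intro s hs hs1 hsub L n
  rcases n with _ | _ | m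
  · -- n = 0 : empty product
    intro q x R _ _ _ _ _ _
    simp [Summit.QuantumFields.YangMills.Cruxes.UVSeamRec.ResponsePinning.torusE_const]
  · -- n = 1 : a centred one-point function vanishes
    intro q x R _ _ _ _ _ _
    have hslk : (0 : ℝ) ≤ (((R : ℝ) * s)⁻¹) ^ σ := pow_nonneg (inv_nonneg.mpr (by positivity)) _
    have h0 : (0 : ℝ) ≤ (C₂ * C₁ * (((0 + 1 : ℕ) : ℝ)) ^ θ / (R : ℝ) ^ 4 * (((R : ℝ) * s)⁻¹) ^ σ) ^ (0 + 1) := by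
      positivity
    simpa [Fin.prod_univ_one, Summit.QuantumFields.YangMills.Theses.SquareRootCeilings.torusE_plane_centred] using h0
  · -- n = m + 2 ≥ 2 : the mirror ceiling dominates every separated pair (RP), K2 gives the square-root gain
    intro q x R hq hR hRs hRL hL₀ hsep
    set a : ℝ := C₁ / (R : ℝ) ^ 4 * (((R : ℝ) * s)⁻¹) ^ σ with ha
    have ha0 : 0 ≤ a := by
      have hslk : (0 : ℝ) ≤ (((R : ℝ) * s)⁻¹) ^ σ := pow_nonneg (inv_nonneg.mpr (by positivity)) _
      exact mul_nonneg (div_nonneg hC₁ (pow_nonneg (Nat.cast_nonneg _) _)) hslk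
    set b : ℝ := a ^ 2 with hb
    have hb0 : 0 ≤ b := sq_nonneg _
    -- the mirror ceiling along the time axis, read at this (β, s, L, R)
    have hmirror : ∀ (q₁ : Fin 4 × Fin 4) (t : ℕ), q₁.1 < q₁.2 → 2 * R + 2 ≤ t → t ≤ L →
        |torusE G r β L (fun U =>
            (plane G r q₁ (fun i => if i = 0 then ((t : ℕ) : ℤ) else 0) U -
                torusE G r β L (plane G r q₁ (fun i => if i = 0 then ((t : ℕ) : ℤ) else 0))) *
              (plane G r q₁ (fun _ => 0) U - torusE G r β L (plane G r q₁ (fun _ => 0))))| ≤ b :=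
      fun q₁ t hq₁ ht htL => H1'' s hs hs1 hsub L q₁ R t hq₁ hR hRs hRL hL₀ ht htL
    -- RP mirror domination: every (2R+4)-separated single-plane pair obeys the same bound
    have hpairs : ∀ (q q' : Fin 4 × Fin 4) (x y : Fin 4 → ℤ), q.1 < q.2 → q'.1 < q'.2 →
        (∃ k : Fin 4, (2 * (R : ℤ) + 4) ≤ |((((x k - y k : ℤ) : ZMod (2 * L + 1))).valMinAbs : ℤ)|) →
        |torusE G r β L (fun U => (plane G r q x U - torusE G r β L (plane G r q x)) *
          (plane G r q' y U - torusE G r β L (plane G r q' y)))| ≤ b := by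
      intro q q' x y hq hq' hk
      obtain ⟨k, hk⟩ := hk
      exact Summit.QuantumFields.YangMills.Theorems.MirrorDomination.abs_cov_le_of_axisMirror G r hβ0 hR hRL
        hmirror hq hq' x y k hk
    have hsqrt : Real.sqrt b = a := by rw [hb, Real.sqrt_sq ha0]
    have key := H2 β hβ₂ L R b hR hRL hb0 hpairs (m + 2) q x hq (by omega) hsep
    calc |torusE G r β L (fun U => ∏ i, (plane G r (q i) (x i) U - torusE G r β L (plane G r (q i) (x i))))|
        ≤ (C₂ * ((m + 2 : ℕ) : ℝ) ^ θ * Real.sqrt b) ^ (m + 2) := key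
      _ = (C₂ * C₁ * ((m + 2 : ℕ) : ℝ) ^ θ / (R : ℝ) ^ 4 * (((R : ℝ) * s)⁻¹) ^ σ) ^ (m + 2) := by
          rw [hsqrt, ha]; ring


/-- edge: the all-tori crux (stmt-QuantumFields-23500) gives the large-volume one (L₀ := 0). -/
theorem slackLargeMirrorCeiling_of_slackMirrorCeiling (h : SlackMirrorCeiling) :
    Summit.QuantumFields.YangMills.Theses.SlackWindow.SlackLargeMirrorCeiling := by
  intro G _ _ _ _ hG hSU
  letI : MeasurableSpace G := borel G
  haveI : BorelSpace G := ⟨rfl⟩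
  intro r v f g h' Λ₅
  obtain ⟨ε₀, hε₀, h1⟩ := h G hG hSU r v f g h' Λ₅
  refine ⟨ε₀, hε₀, fun ε hε hεε hfl => ?_⟩
  obtain ⟨σ, C, ℓ₄, β₄, hℓ₄, hC, h2⟩ := h1 ε hε hεε hfl
  refine ⟨σ, C, ℓ₄, β₄, hℓ₄, hC, fun β hβ => ⟨0, fun s hs hs1 hsub L q R t hq hR hRs hRL _ ht htL => ?_⟩⟩
  exact h2 β hβ s hs hs1 hsub L q R t hq hR hRs hRL ht htL

end Summit.QuantumFields.YangMills.Theorems.SlackWindow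

end
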